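import Summits.QuantumFields.YangMills.Theorems.FemtoCurvatureSkewness.Negative.WeakCoupling
import Summits.QuantumFields.YangMills.Theorems.LangevinControlUVFemtoCurvatureSkewnessEventualNonvanishing
import Summits.QuantumFields.YangMills.Theorems.LangevinControlUVFemtoCurvatureSkewnessImpliesC
import Summits.QuantumFields.YangMills.Theorems.LangevinControlUVLatticeGapInUVUnitsRulerRigidity
import Summits.QuantumFields.YangMills.Theorems.FemtoCurvatureSkewness.Negative.PackagePinsScale
import Summits.QuantumFields.YangMills.Theorems.LangevinControlUVFemtoCurvatureSkewnessAnalyticCoupling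

/-!
# Disproof of `FemtoCurvatureSkewnessC` (crux `stmt-QuantumFields-16205`, route `LangevinControlUV`) — findings

Standing-adversary work file (cdisprove gen 1, 2026-08-16).  Prose lives in docstrings; NO `sorry` in this file.  Everything is
kernel-checked over tree objects and the LANDED negative-side toolkit of the typed predecessor 9365
(`Theorems/FemtoCurvatureSkewness/Negative/*`), the landed R1 analysis of line `coupling-cubic-response`
(`…SkewnessEventualNonvanishing`, `…SkewnessImpliesC`), the landed ruler rigidity (`…LatticeGapInUVUnitsRulerRigidity`) and this
seat's landed support file `Theorems/FemtoCurvatureSkewnessC/Negative/ContinuityContent.lean` (p122377).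

## What the crux says (`femtoCurvatureSkewnessC_iff`, landed, `Iff.rfl`)
`∀ G` compact simple Lie, `∀ r : LatticeRep G`:
`(∃ a, Continuous a ∧ TwoPointPackage r a) → ∃ a, Continuous a ∧ TwoPointPackage r a ∧ SkewnessPackage r a`.
Hypothesis = body of the tier-deciding crux `FemtoCurvatureTwoPointC` (16204) at `(G, r)`; the conclusion RE-quantifies the unit map
(∃-bundled on purpose, repair R1) and asks the skewness witness `c₃ Γ₃(n a β) ≤ n¹²|κ₃(P_0^{01}, P_{ne₂}^{01}, P_{ne₃}^{01})|` on the
femto boxes `β ≥ β₁`, `L a(β) ≤ ℓ₁`, `1 ≤ n ≤ L/8` of the map it names.  No junk handle: `IsCompactSimpleLieGroup` excludes finite /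
abelian / unfaithful data, and in any case the PACKAGE hypothesis fails for them (`Cov > 0` forced; sibling disproof § LoadBearing).

## Findings
1. **Shield (why no unconditional kill exists).**  `refutationC_needs_twoPointC_witness` (landed): every refutation exhibits a
   CONTINUOUS map carrying the two-point package for some compact simple `(G, r)` — an instance of the open crux 16204 (the femto
   continuum limit with observables).  Conversely vacuous truth needs `¬16204` at every `(G, r)`.  Neither is constructible.
2. **LOAD-BEARING: the OUTPUT token `Continuous a`** (`droppingOutputContinuity_iff_eventual`, landed): delete it from the
   conclusion and the crux is EQUIVALENT to fixed-torus eventual non-vanishing `∀ L ≥ 8n ≥ 8, ∀ᶠ β → ∞, κ₃(L, β, n) ≠ 0` for every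
   `(G, r)` with a continuous package map — no unit map, no RG chain (the wild-map collapse of plain R1, landed by line c-c-r c3).
   The crux implies that residue (`eventual_of_cruxC`): it is the a-free part NO output map can soften, and it is believed TRUE
   (finite-dimensional Laplace asymptotics on one torus: `β³ n¹² κ₃(L, β, n) →` toron-averaged lattice triangle `> 0`, zero-mode
   corrections of relative size `O((n/L)⁴) ≤ O(8⁻⁴)`; MC SU(2) `L = 6, 8`, `n = 1`: `κ₃ > 0` at 7–34σ, MCSignScan-c1 of crux 9365).
3. **What the token re-imposes** (`chain_lower_of_continuous`, landed): for a CONTINUOUS package map the skewness package yields ONE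
   constant `γ(s) > 0` per physical size `s` with `γ(s) ≤ n¹²|κ₃(L, β, n)|` at every admissible `(L, β)` on the level `n a(β) = s`, and
   EVERY resolution `n` is realised on that level (intermediate values; box `L = 8n` admissible): uniformity in `n → ∞` at fixed physical
   geometry — the femto continuum limit of the plaquette three-point function bounded away from `0`.  THIS is the ultraviolet bet.
4. **Exact kill criterion** (`not_cruxC_of_zeros_in_shrinking_boxes`, landed): a continuous package witness `a₀` plus exact zeros
   `κ₃(L_k, β_k, n_k) = 0`, `β_k → ∞`, in boxes of VANISHING physical size `L_k a₀(β_k) → 0`.  By ruler rigidity (landed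
   `rulerRigidity_continuous`; restated here as `continuous_package_maps_comparable`) every continuous package map is `≍ a₀`, so the
   prover's freedom in `∃ a` is constants only (`twoPointPackage_const_mul` / `skewnessPackage_const_mul` below realise exactly that
   freedom) and cannot dodge such zeros.  Zeros at physical size bounded below — the infrared sign flip (strong-coupling sign `−` for
   `r ⊗ r ∋ r` or `r̄`, e.g. SU(3) fundamental; sibling Disproof finding 3) that makes the TYPED `∀ a` item false modulo uniformities
   (`FemtoCurvatureSkewness_false_of_UniformZeros`) — are inadmissible here: the repair R1∘C′ did its job.  What would meet the
   criterion is a failure of asymptotic freedom for the three-point but not the two-point function; tree sign `+` at every `(L, n)`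
   (landed `PerpPropagatorPos`, `TreeRatioFloor`), next order `O(g²(s)) → 0`.  No candidate `(G, r)`; no printed counterexample
   (lit search degraded this session: searchd reset, arXiv 0 hits, OpenAlex 429 — recorded, not decisive).
5. **Other load-bearing clauses** (§2 below): the weak-coupling threshold `β₁` (β = 0 is an exact zero: landed `kappa3_zero_coupling`;
   `not_exists_allCouplings`); `inf Γ₃ > 0` impossible (`not_exists_uniform`, from landed `not_uniformSkewness`) — Γ₃ must vanish at
   `0⁺` (asymptotic-freedom dividend, `skewnessShape_tendsto_zero`); the femto GUARD `L a ≤ ℓ₁` of the conclusion is load-bearing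
   exactly modulo the infrared sign question (`globalNonvanishing_of_noGuard`, `not_noGuard_of_infrared_zeros`).  Hypothesis-side
   tokens: dropping `Continuous` from the HYPOTHESIS only strengthens the crux (`cruxC_of_inputContinuityDropped`); dropping
   `IsCompactSimpleLieGroup` is harmless as far as anyone can tell (the package already excludes every junk model) — "possibly unnecessary".
6. **Line `ratio-transport` (slug `Sketch`, picked 19:11Z; stubs E / A / M / S) — first-pass adversarial audit, paper:**
   * S `stub_signedRigidityOfRatioFloor`: TRUE and elementary (package lower clause ⇒ `Cov > 0`; `u ≥ u₁` ⇒ `κ₃ ≥ u₁ (G_d/G_a) Cov^{3/2}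
     ≥ u₁ ρ₀ Cov √Cov` by `treeRatioFloor_holds`, `Real.rpow` algebra `x^{3/2} = x √x` for `x > 0`).  Nothing to attack.
   * M `stub_ratioFloorOfTransports`: the abstract descent CLOSES with the reshaped UNIFORM anchor constant; order of constants
     `u₀ → δ := u₀/8 → N₀(δ) (enlarged until C_S/N₀ + C_V 8⁻⁵/N₀ ≤ u₀/8) → K₀ ((16/15)C_V K₀⁻⁴ ≤ u₀/8) → finite anchor family
     {1 ≤ n₀ < 2N₀, 8n₀ ≤ L₀' ≤ K₀n₀} → B_max → ℓ₁ (a(β) ≤ ℓ₁/8 ⇒ β ≥ B_max ∨ all β₁'s; ℓ₁ ≤ min ℓ₁^{T·})`; coarse chain points stay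
     femto because the volume is reduced BEFORE the cutoff steps (`2^k L₀' ≤ L`).  Junk `(G, r)` (trivial group: `u ≡ 0`) make the
     anchors false, so the stub is vacuous there — no junk refutation.  Only an abstract-shape attack exists, and the shape is right.
   * A `stub_anchors`: plausible with `u₀ = ½·2^{3/2}(dim G)^{-1/2}` — the tree value of `u` is EXACTLY `2^{3/2} d^{-1/2}` at every
     `(L, n)` because `skewRatioT` divides out the exact zero-mode-free torus propagators; torons / constant modes enter the fixed-torus
     limit at relative `O((n/L)⁴)`.  It is precisely finding 2's residue WITH VALUE; not attackable without a 16204 witness.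
   * E `stub_ratioTransportEngine`: the crux-sized engine.  Note for the lead: E must output an HONEST (strictly antitone) map whose OWN
     cutoff transport is summable — i.e. `a` must track the physical step-scaling map to summable accuracy along chains (a bounded but
     non-convergent wiggle `θ(β)` in `a = θ·a_AF` costs `g⁴·|log θ/θ'|` per step, not summable); define `a` from the step-scaling
     function itself.  The crux's `∃ a` permits exactly this choice.
   JOINT SUFFICIENCY: `FemtoCurvatureSkewnessC_of` is sorry-free over the four stubs (kernel-checked in `Lines/Sketch.lean`); no gap.

## Index (this file)
§1 readback (cites) · §2 load-bearing clauses (`not_exists_allCouplings`, `not_exists_uniform`, `NoGuardConclusion`,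
`globalNonvanishing_of_noGuard`, `not_noGuard_of_infrared_zeros`, `cruxC_of_inputContinuityDropped`) · §3 the `∃ a` freedom
(`twoPointPackage_const_mul`, `skewnessPackage_const_mul`, `cruxC_rescale`, `continuous_package_maps_comparable`) · §4 kill-criterion
corollaries (`not_cruxC_of_identically_zero_torus`, analyticity dichotomy remark) · §5 near-misses / targets (prose).
LANDED (imported): `ContinuityContent.lean` p122377 — `droppingOutputContinuity_iff_eventual`, `eventual_of_cruxC`,
`chain_lower_of_continuous`, `refutationC_needs_twoPointC_witness`, `not_cruxC_of_frequently_zero`, `not_cruxC_of_zeros_in_shrinking_boxes`.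

TEMPORARY LAYOUT NOTE: §CC (first namespace block below) is a VERBATIM inline copy of this seat's LANDED support file
`Theorems/FemtoCurvatureSkewnessC/Negative/ContinuityContent.lean` (p122377, commit 84904a05) — inlined only because the farm had not
yet built that module when this work file was published; the import-based version (`import …FemtoCurvatureSkewnessC.Negative.ContinuityContent`)
is kept in the disprover's folder as `Disproof.lean` and replaces this layout at the next publication.
-/

/-! ## §CC-inline — landed `ContinuityContent.lean` (p122377), verbatim up to the namespace (`…Disproof.CCInline` here, `…Theorems.FemtoCurvatureSkewnessC.Negative` in the tree) -/



set_option autoImplicit false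

noncomputable section

namespace Summit.QuantumFields.YangMills.Cruxes.FemtoCurvatureSkewnessC.Disproof.CCInline

open MeasureTheory Filter Topology
open Literature.MathematicalPhysics.QuantumFieldTheory
open Summit.QuantumFields.YangMills.Theses.LangevinControlUV (FemtoCurvatureSkewnessC)
open Summit.QuantumFields.YangMills.Theorems.FemtoCurvatureSkewness.Negative
open Summit.QuantumFields.YangMills.Theorems.FemtoCurvatureSkewness (femtoCurvatureSkewnessC_iff)
open Summit.QuantumFields.YangMills.Cruxes.FemtoCurvatureSkewness.CouplingCubicResponse
  (exists_package_and_skewness_of_eventually_ne_zero)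
open Summit.QuantumFields.YangMills.Theorems.LatticeGapInUVUnits.OneRuler (rulerRigidity_continuous)

/-! ## §1 The output continuity token is load-bearing: without it, only fixed-torus eventual non-vanishing is left -/

/-- **Dropping `Continuous` from the OUTPUT map leaves exactly fixed-torus eventual non-vanishing.**  The crux with the token
deleted from its conclusion (left-hand side) is EQUIVALENT to: for every compact simple `G` and every `r` admitting a continuous
package map, `κ₃(L, β, n) ≠ 0` for all sufficiently large `β` on every torus `L ≥ 8n ≥ 8` (right-hand side).  (→) is the landed
`eventually_kappa3_ne_zero`; (←) is the landed wild-map construction `exists_package_and_skewness_of_eventually_ne_zero` — the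
map it returns is choice-constructed with singleton level sets, not even measurable: the ∃-bundled conclusion has ultraviolet
content ONLY through the continuity of the map it names. -/
theorem droppingOutputContinuity_iff_eventual :
    (∀ (G : Type) [Group G] [TopologicalSpace G] [IsTopologicalGroup G] [CompactSpace G],
      IsCompactSimpleLieGroup G →
        letI : MeasurableSpace G := borel G
        haveI : BorelSpace G := ⟨rfl⟩
        ∀ (r : LatticeRep G), (∃ a : ℝ → ℝ, Continuous a ∧ TwoPointPackage r a) →
          ∃ a : ℝ → ℝ, TwoPointPackage r a ∧ SkewnessPackage r a) ↔
    ∀ (G : Type) [Group G] [TopologicalSpace G] [IsTopologicalGroup G] [CompactSpace G],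
      IsCompactSimpleLieGroup G →
        letI : MeasurableSpace G := borel G
        haveI : BorelSpace G := ⟨rfl⟩
        ∀ (r : LatticeRep G), (∃ a : ℝ → ℝ, Continuous a ∧ TwoPointPackage r a) →
          ∀ (L : ℕ) [NeZero L] (n : ℕ), 1 ≤ n → 8 * n ≤ L → ∀ᶠ β in atTop, kappa3 r L β n ≠ 0 := by
  constructor
  · intro h G _ _ _ _ hG
    letI : MeasurableSpace G := borel G
    haveI : BorelSpace G := ⟨rfl⟩
    intro r hex L _ n hn h8
    obtain ⟨a, hP, hS⟩ := h G hG r hex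
    obtain ⟨Γ, β₀, ℓ₀, c, C, -, -, ha, ha0, -⟩ := id hP
    exact eventually_kappa3_ne_zero r ha ha0 hS L n hn h8
  · intro h G _ _ _ _ hG
    letI : MeasurableSpace G := borel G
    haveI : BorelSpace G := ⟨rfl⟩
    intro r hex
    obtain ⟨a₀, -, h₀⟩ := id hex
    obtain ⟨a, -, hP, hS⟩ :=
      exists_package_and_skewness_of_eventually_ne_zero r h₀ (fun L _ n hn h8 => h G hG r hex L n hn h8)
    exact ⟨a, hP, hS⟩

/-- **The a-free residue of the crux**: `FemtoCurvatureSkewnessC` implies fixed-torus eventual non-vanishing of `κ₃` for every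
compact simple `G` and every `r` with a continuous package map (forget the output token, then `droppingOutputContinuity_iff_eventual`). -/
theorem eventual_of_cruxC (h : FemtoCurvatureSkewnessC) :
    ∀ (G : Type) [Group G] [TopologicalSpace G] [IsTopologicalGroup G] [CompactSpace G],
      IsCompactSimpleLieGroup G →
        letI : MeasurableSpace G := borel G
        haveI : BorelSpace G := ⟨rfl⟩
        ∀ (r : LatticeRep G), (∃ a : ℝ → ℝ, Continuous a ∧ TwoPointPackage r a) →
          ∀ (L : ℕ) [NeZero L] (n : ℕ), 1 ≤ n → 8 * n ≤ L → ∀ᶠ β in atTop, kappa3 r L β n ≠ 0 := by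
  refine droppingOutputContinuity_iff_eventual.1 fun G _ _ _ _ hG => ?_
  letI : MeasurableSpace G := borel G
  haveI : BorelSpace G := ⟨rfl⟩
  intro r hex
  obtain ⟨a, -, hP, hS⟩ := femtoCurvatureSkewnessC_iff.1 h G hG r hex
  exact ⟨a, hP, hS⟩

/-! ## §2 What the output continuity re-imposes: a uniform lower bound along every RG chain -/

section Chain

variable {G : Type} [Group G] [TopologicalSpace G] [IsTopologicalGroup G] [CompactSpace G]
  [MeasurableSpace G] [BorelSpace G]

omit [Group G] [TopologicalSpace G] [IsTopologicalGroup G] [CompactSpace G] [MeasurableSpace G] [BorelSpace G] in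
/-- Intermediate values of a continuous unit map: every level `t ∈ (0, a β)` is attained at a LATER coupling (local copy of the
sibling work file's `exists_later_level`). -/
theorem exists_later_level' {a : ℝ → ℝ} (hcont : Continuous a) (hat : Tendsto a atTop (𝓝 0)) (β : ℝ) {t : ℝ}
    (ht0 : 0 < t) (ht : t < a β) : ∃ β' : ℝ, β < β' ∧ a β' = t := by
  obtain ⟨B, hBt, hβB⟩ := ((hat.eventually (Iio_mem_nhds ht0)).and (eventually_gt_atTop β)).exists
  obtain ⟨x, hx, hxt⟩ :=
    intermediate_value_Icc' hβB.le hcont.continuousOn ⟨(le_of_lt hBt), ht.le⟩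
  refine ⟨x, lt_of_le_of_ne hx.1 ?_, hxt⟩
  rintro rfl
  exact absurd hxt (ne_of_gt ht)

/-- **What `Continuous a` re-imposes: ONE constant per physical size, uniformly along the RG chain.**  If a CONTINUOUS positive
unit map `a → 0` carries the skewness package then there are `β₁`, `ℓ₁` and `ℓ > 0` (`8ℓ ≤ ℓ₁`) such that for every physical size
`0 < s ≤ ℓ` one constant `γ(s) > 0` satisfies: for EVERY resolution `n ≥ 1` (i) some later coupling `β > β₁` realises the level,
`n · a(β) = s`, with the box `L = 8n` admissible (`8n · a(β) ≤ ℓ₁`), and (ii) `γ(s) ≤ n¹² |κ₃(L, β, n)|` at every admissible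
`(L, β)` on that level.  Uniform in `n → ∞` at fixed physical geometry — the femto continuum content of the crux. -/
theorem chain_lower_of_continuous (r : LatticeRep G) {a : ℝ → ℝ} (hS : SkewnessPackage r a) (ha : ∀ β, 0 < a β)
    (ha0 : Tendsto a atTop (𝓝 0)) (hcont : Continuous a) :
    ∃ β₁ ℓ₁ ℓ : ℝ, 0 < ℓ ∧ 8 * ℓ ≤ ℓ₁ ∧ ∀ s : ℝ, 0 < s → s ≤ ℓ → ∃ γ : ℝ, 0 < γ ∧ ∀ n : ℕ, 1 ≤ n →
      (∃ β : ℝ, β₁ < β ∧ (n : ℝ) * a β = s ∧ ((8 * n : ℕ) : ℝ) * a β ≤ ℓ₁) ∧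
      ∀ (L : ℕ) [NeZero L] (β : ℝ), β₁ ≤ β → (L : ℝ) * a β ≤ ℓ₁ → 8 * n ≤ L → (n : ℝ) * a β = s →
        γ ≤ (n : ℝ) ^ 12 * |kappa3 r L β n| := by
  obtain ⟨Γ₃, β₁, ℓ₁, c₃, hℓ₁, hc₃, hΓ₃, hb⟩ := hS
  refine ⟨β₁, ℓ₁, min (ℓ₁ / 8) (a β₁ / 2), lt_min (by linarith) (by linarith [ha β₁]),
    by linarith [min_le_left (ℓ₁ / 8) (a β₁ / 2)], fun s hs hsℓ => ?_⟩
  have hs8 : 8 * s ≤ ℓ₁ := by linarith [min_le_left (ℓ₁ / 8) (a β₁ / 2)]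
  have hsa : s < a β₁ := by linarith [min_le_right (ℓ₁ / 8) (a β₁ / 2), ha β₁]
  refine ⟨c₃ * Γ₃ s, mul_pos hc₃ (hΓ₃ s hs (by linarith)), fun n hn => ⟨?_, fun L _ β hβ hL h8 hns => ?_⟩⟩
  · have hn0 : (0 : ℝ) < n := by exact_mod_cast hn
    have hlt : s / n < a β₁ := by
      calc s / n ≤ s := div_le_self hs.le (by exact_mod_cast hn)
        _ < a β₁ := hsa
    obtain ⟨β, hβ, hβs⟩ := exists_later_level' hcont ha0 β₁ (div_pos hs hn0) hlt
    have hns : (n : ℝ) * a β = s := by rw [hβs]; field_simp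
    exact ⟨β, hβ, hns, by push_cast; nlinarith [hns, hs8]⟩
  · have key := hb L β hβ hL n hn h8
    rwa [hns] at key

end Chain

/-! ## §3 The shield and the two kill criteria -/

/-- **The shield.**  Any refutation of the crux produces `(G, r, a₀)` with `G` compact simple, `a₀` CONTINUOUS and
`TwoPointPackage r a₀` — an instance of the open crux `FemtoCurvatureTwoPointC` at `(G, r)` — together with the failure of the
skewness package for EVERY continuous package map of that `(G, r)`. -/
theorem refutationC_needs_twoPointC_witness (h : ¬ FemtoCurvatureSkewnessC) :
    ∃ (G : Type) (_ : Group G) (_ : TopologicalSpace G) (_ : IsTopologicalGroup G)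
      (_ : CompactSpace G) (_ : IsCompactSimpleLieGroup G),
      letI : MeasurableSpace G := borel G
      haveI : BorelSpace G := ⟨rfl⟩
      ∃ (r : LatticeRep G) (a₀ : ℝ → ℝ), Continuous a₀ ∧ TwoPointPackage r a₀ ∧
        ∀ a : ℝ → ℝ, Continuous a → TwoPointPackage r a → ¬ SkewnessPackage r a := by
  by_contra hno
  apply h
  intro G _ _ _ _ hG
  letI : MeasurableSpace G := borel G
  haveI : BorelSpace G := ⟨rfl⟩
  intro r hex
  obtain ⟨a₀, ha₀, h₀⟩ := hex
  by_contra hS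
  exact hno ⟨G, _, _, _, _, hG, r, a₀, ha₀, h₀, fun a ha hP hSk => hS ⟨a, ha, hP, hSk⟩⟩

/-- **Kill criterion I (a-free: one torus, zeros at arbitrarily large coupling).**  A continuous two-point witness plus ONE torus
`L ≥ 8n` on which `β ↦ κ₃(L, β, n)` vanishes frequently as `β → ∞` refutes the crux: whatever continuous map the crux answers with,
its windows contain a neighbourhood of `+∞` on every fixed torus. -/
theorem not_cruxC_of_frequently_zero
    (h : ∃ (G : Type) (_ : Group G) (_ : TopologicalSpace G) (_ : IsTopologicalGroup G)
      (_ : CompactSpace G) (_ : IsCompactSimpleLieGroup G),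
      letI : MeasurableSpace G := borel G
      haveI : BorelSpace G := ⟨rfl⟩
      ∃ (r : LatticeRep G) (a₀ : ℝ → ℝ), Continuous a₀ ∧ TwoPointPackage r a₀ ∧
        ∃ (L : ℕ) (_ : NeZero L) (n : ℕ), 1 ≤ n ∧ 8 * n ≤ L ∧ ∃ᶠ β in atTop, kappa3 r L β n = 0) :
    ¬ FemtoCurvatureSkewnessC := by
  intro hcrux
  obtain ⟨G, _, _, _, _, hG, r, a₀, ha₀, h₀, L, _, n, hn, h8, hfreq⟩ := h
  letI : MeasurableSpace G := borel G
  haveI : BorelSpace G := ⟨rfl⟩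
  exact hfreq (eventual_of_cruxC hcrux G hG r ⟨a₀, ha₀, h₀⟩ L n hn h8)

/-- **Kill criterion II (the exact exposure of R1∘C′): zeros in physically shrinking boxes.**  A continuous two-point witness `a₀`
for `(G, r)` together with exact zeros of the cumulant above every coupling `b` and inside boxes of ARBITRARILY SMALL physical size in
the ruler `a₀` (`L · a₀(β) ≤ ε`) refutes the crux: by ruler rigidity (`rulerRigidity_continuous`, landed) the continuous package map
`a` returned by the crux satisfies `a ≤ K · a₀` eventually, so such zeros are admissible for its skewness window whatever `β₁, ℓ₁`
are — and an admissible exact zero contradicts `c₃ Γ₃ > 0`. -/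
theorem not_cruxC_of_zeros_in_shrinking_boxes
    (h : ∃ (G : Type) (_ : Group G) (_ : TopologicalSpace G) (_ : IsTopologicalGroup G)
      (_ : CompactSpace G) (_ : IsCompactSimpleLieGroup G),
      letI : MeasurableSpace G := borel G
      haveI : BorelSpace G := ⟨rfl⟩
      ∃ (r : LatticeRep G) (a₀ : ℝ → ℝ), Continuous a₀ ∧ TwoPointPackage r a₀ ∧
        ∀ ε b : ℝ, 0 < ε → ∃ (L : ℕ) (_ : NeZero L) (β : ℝ) (n : ℕ),
          b ≤ β ∧ (L : ℝ) * a₀ β ≤ ε ∧ 1 ≤ n ∧ 8 * n ≤ L ∧ kappa3 r L β n = 0) :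
    ¬ FemtoCurvatureSkewnessC := by
  intro hcrux
  obtain ⟨G, _, _, _, _, hG, r, a₀, ha₀, h₀, hzero⟩ := h
  letI : MeasurableSpace G := borel G
  haveI : BorelSpace G := ⟨rfl⟩
  obtain ⟨a, ha, hP, hS⟩ := hcrux G hG r ⟨a₀, ha₀, h₀⟩
  obtain ⟨Γ₀, β₀, ℓ₀, c, C, h₁⟩ := h₀
  obtain ⟨Γ, β₀', ℓ₀', c', C', h₂⟩ := hP
  have hapos : ∀ β, 0 < a β := h₂.2.2.1
  obtain ⟨K, β₃, hK, hKβ⟩ :=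
    rulerRigidity_continuous G r a₀ a Γ₀ Γ β₀ ℓ₀ c C β₀' ℓ₀' c' C' h₁ h₂ ha₀ ha
  have hS' : SkewnessPackage r a := hS
  obtain ⟨Γ₃, β₁, ℓ₁, c₃, hℓ₁, hc₃, hΓ₃, hb⟩ := hS'
  obtain ⟨L, _, β, n, hβ, hLε, hn, h8, hz⟩ := hzero (ℓ₁ / K) (max β₁ β₃) (div_pos hℓ₁ hK)
  have hLa : (L : ℝ) * a β ≤ ℓ₁ := by
    have h1 : a β ≤ K * a₀ β := (hKβ β (le_of_max_le_right hβ)).1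
    calc (L : ℝ) * a β ≤ (L : ℝ) * (K * a₀ β) := mul_le_mul_of_nonneg_left h1 (Nat.cast_nonneg L)
      _ = K * ((L : ℝ) * a₀ β) := by ring
      _ ≤ K * (ℓ₁ / K) := mul_le_mul_of_nonneg_left hLε hK.le
      _ = ℓ₁ := mul_div_cancel₀ _ hK.ne'
  have key := hb L β (le_of_max_le_left hβ) hLa n hn h8
  rw [hz, abs_zero, mul_zero] at key
  obtain ⟨hs, hsℓ⟩ := level_mem_window hapos hLa hn h8
  exact absurd key (not_le.2 (mul_pos hc₃ (hΓ₃ _ hs hsℓ)))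

end Summit.QuantumFields.YangMills.Cruxes.FemtoCurvatureSkewnessC.Disproof.CCInline



set_option autoImplicit false

noncomputable section

namespace Summit.QuantumFields.YangMills.Cruxes.FemtoCurvatureSkewnessC.Disproof

open MeasureTheory Filter Topology
open Literature.MathematicalPhysics.QuantumFieldTheory
open Summit.QuantumFields.YangMills.Theses.LangevinControlUV (FemtoCurvatureSkewnessC)
open Summit.QuantumFields.YangMills.Theorems.FemtoCurvatureSkewness.Negative
open Summit.QuantumFields.YangMills.Theorems.FemtoCurvatureSkewness (femtoCurvatureSkewnessC_iff kappa3_zero_set_dichotomy)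
open Summit.QuantumFields.YangMills.Cruxes.FemtoCurvatureSkewnessC.Disproof.CCInline
open Summit.QuantumFields.YangMills.Theorems.LatticeGapInUVUnits.OneRuler (rulerRigidity_continuous)

/-! ## §1 Readback

`femtoCurvatureSkewnessC_iff` (landed, `…SkewnessImpliesC.lean`) is `Iff.rfl`: the crux IS
`∀ G simple r, (∃ a, Continuous a ∧ TwoPointPackage r a) → ∃ a, Continuous a ∧ TwoPointPackage r a ∧ SkewnessPackage r a`.
Symbol-by-symbol: `P = N − Re tr r(U_p) ∈ [0, 2N]`; `E = wilsonExpectation` (tree normalisation `e^{-β Σ P}`); `cov`, `κ₃` the honest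
second / third cumulants; `dist` = Euclidean `valMinAbs` torus distance; `L ≥ 8n ≥ 8` in every clause (`ZMod L` fine, `(1 : ZMod L) ≠ 0`);
no `ℕ`-subtraction, no division, no `tsum`/`sSup`; coercions `ℕ → ℝ` only.  Quantifier order matches the informal text. -/

/-- The crux in the landed vocabulary (re-export of the landed `Iff.rfl`, for readers of this file). -/
theorem cruxC_iff : FemtoCurvatureSkewnessC ↔
    ∀ (G : Type) [Group G] [TopologicalSpace G] [IsTopologicalGroup G] [CompactSpace G],
      IsCompactSimpleLieGroup G →
        letI : MeasurableSpace G := borel G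
        haveI : BorelSpace G := ⟨rfl⟩
        ∀ (r : LatticeRep G), (∃ a : ℝ → ℝ, Continuous a ∧ TwoPointPackage r a) →
          ∃ a : ℝ → ℝ, Continuous a ∧ TwoPointPackage r a ∧ SkewnessPackage r a :=
  femtoCurvatureSkewnessC_iff

/-! ## §2 Load-bearing clauses of the conclusion (beyond the output token, which is `ContinuityContent` §1) -/

section LoadBearing

variable {G : Type} [Group G] [TopologicalSpace G] [IsTopologicalGroup G] [CompactSpace G]
  [MeasurableSpace G] [BorelSpace G]

/-- **`β₁` is load-bearing**: no unit map at all (continuous or not) carries the all-couplings strengthening of the skewness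
package, because `β = 0` is an exact zero of `κ₃` on every torus (landed `not_skewnessBoundAllCouplings`). -/
theorem not_exists_allCouplings (r : LatticeRep G) :
    ¬ ∃ a : ℝ → ℝ, Continuous a ∧ TwoPointPackage r a ∧ SkewnessBoundAllCouplings r a := by
  rintro ⟨a, -, hP, hS⟩
  obtain ⟨Γ, β₀, ℓ₀, c, C, -, -, ha, -, -⟩ := id hP
  exact not_skewnessBoundAllCouplings r a ha hS

/-- **`Γ₃ → 0⁺` is forced (no scale-invariant skewness)**: no unit map carries the package together with a UNIFORM lower bound
`c₃ ≤ n¹²|κ₃|` on its femto boxes (landed `not_uniformSkewness`: fixed-torus concentration `κ₃ → 0`). -/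
theorem not_exists_uniform (r : LatticeRep G) :
    ¬ ∃ a : ℝ → ℝ, Continuous a ∧ TwoPointPackage r a ∧ UniformSkewness r a := by
  rintro ⟨a, -, hP, hS⟩
  obtain ⟨Γ, β₀, ℓ₀, c, C, -, -, ha, ha0, -⟩ := id hP
  exact not_uniformSkewness r ha ha0 hS

/-- The conclusion's skewness clause with the femto GUARD `L · a β ≤ ℓ₁` deleted (and `Γ₃ > 0` on all of `(0, ∞)`, since without
the guard the argument `n · a β` is unbounded): a lower bound in ALL volumes above `β₁`. -/
def NoGuardConclusion (r : LatticeRep G) (a : ℝ → ℝ) : Prop :=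
  ∃ (Γ₃ : ℝ → ℝ) (β₁ c₃ : ℝ), 0 < c₃ ∧ (∀ s : ℝ, 0 < s → 0 < Γ₃ s) ∧
    ∀ (L : ℕ) [NeZero L] (β : ℝ), β₁ ≤ β →
      ∀ n : ℕ, 1 ≤ n → 8 * n ≤ L → c₃ * Γ₃ ((n : ℝ) * a β) ≤ (n : ℝ) ^ 12 * |kappa3 r L β n|

/-- **Without the femto guard the conclusion is GLOBAL non-vanishing** of `κ₃` above `β₁` in all volumes (confinement-scale
triangles included) — the a-free infrared statement `GlobalSkewSign`-up-to-sign that no ultraviolet line supplies. -/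
theorem globalNonvanishing_of_noGuard (r : LatticeRep G) {a : ℝ → ℝ} (ha : ∀ β, 0 < a β) (h : NoGuardConclusion r a) :
    ∃ β₁ : ℝ, ∀ (L : ℕ) [NeZero L] (β : ℝ) (n : ℕ), β₁ ≤ β → 1 ≤ n → 8 * n ≤ L → kappa3 r L β n ≠ 0 := by
  obtain ⟨Γ₃, β₁, c₃, hc₃, hΓ₃, hb⟩ := h
  refine ⟨β₁, fun L _ β n hβ hn h8 h0 => ?_⟩
  have key := hb L β hβ n hn h8
  rw [h0, abs_zero, mul_zero] at key
  have hn' : (0 : ℝ) < n := by exact_mod_cast hn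
  exact absurd key (not_le.2 (mul_pos hc₃ (hΓ₃ _ (mul_pos hn' (ha β)))))

/-- **So the guard is load-bearing exactly modulo the infrared sign question**: exact zeros of `κ₃` at arbitrarily large coupling
in SOME volumes (forced on every torus carrying a strong→weak sign change, `exists_zero_of_sign_change`; whether they persist as
`β → ∞` is the open IR-sign question for `(G, r)` with `r ⊗ r ∋ r` or `r̄`) kill the guard-free conclusion for every unit map. -/
theorem not_noGuard_of_infrared_zeros (r : LatticeRep G) {a : ℝ → ℝ} (ha : ∀ β, 0 < a β)
    (hz : ∀ b : ℝ, ∃ (L : ℕ) (_ : NeZero L) (β : ℝ) (n : ℕ), b ≤ β ∧ 1 ≤ n ∧ 8 * n ≤ L ∧ kappa3 r L β n = 0) :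
    ¬ NoGuardConclusion r a := by
  intro h
  obtain ⟨β₁, hne⟩ := globalNonvanishing_of_noGuard r ha h
  obtain ⟨L, _, β, n, hβ, hn, h8, h0⟩ := hz β₁
  exact hne L β n hβ hn h8 h0

end LoadBearing

/-- **Hypothesis-side token**: deleting `Continuous` from the HYPOTHESIS only strengthens the item (more `(G, r)` qualify), so
nothing negative can be said about that token from this side; recorded for completeness (the glue `closes` feeds a continuous map). -/
theorem cruxC_of_inputContinuityDropped
    (h : ∀ (G : Type) [Group G] [TopologicalSpace G] [IsTopologicalGroup G] [CompactSpace G],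
      IsCompactSimpleLieGroup G →
        letI : MeasurableSpace G := borel G
        haveI : BorelSpace G := ⟨rfl⟩
        ∀ (r : LatticeRep G), (∃ a : ℝ → ℝ, TwoPointPackage r a) →
          ∃ a : ℝ → ℝ, Continuous a ∧ TwoPointPackage r a ∧ SkewnessPackage r a) :
    FemtoCurvatureSkewnessC := by
  rw [cruxC_iff]
  intro G _ _ _ _ hG
  letI : MeasurableSpace G := borel G
  haveI : BorelSpace G := ⟨rfl⟩
  intro r hex
  obtain ⟨a₀, -, h₀⟩ := hex
  exact h G hG r ⟨a₀, h₀⟩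

/-! ## §3 The `∃ a` freedom of the conclusion is constants only -/

section Freedom

variable {G : Type} [Group G] [TopologicalSpace G] [IsTopologicalGroup G] [CompactSpace G]
  [MeasurableSpace G] [BorelSpace G]

/-- **Rescaling up is free for the two-point package**: `a ↦ M·a` (`M ≥ 1`) shrinks the femto boxes and relabels the shape,
`Γ'(s) := Γ(s/M)`; thresholds and constants unchanged. -/
theorem twoPointPackage_const_mul (r : LatticeRep G) {a : ℝ → ℝ} (h : TwoPointPackage r a) {M : ℝ} (hM : 1 ≤ M) :
    TwoPointPackage r (fun β => M * a β) := by
  obtain ⟨Γ, β₀, ℓ₀, c, C, hℓ₀, hc, ha, ha0, hΓ, hbox⟩ := h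
  have hM0 : 0 < M := lt_of_lt_of_le one_pos hM
  refine ⟨fun s => Γ (s / M), β₀, ℓ₀, c, C, hℓ₀, hc, fun β => mul_pos hM0 (ha β), ?_, ?_, ?_⟩
  · simpa using ha0.const_mul M
  · intro s hs hsℓ
    refine hΓ (s / M) (div_pos hs hM0) ?_
    rw [div_le_iff₀ hM0]
    nlinarith
  · intro L _ β hβ hL
    have hL' : (L : ℝ) * a β ≤ ℓ₀ := by
      have h1 : (L : ℝ) * a β ≤ (L : ℝ) * (M * a β) := by
        have := mul_le_mul_of_nonneg_left (le_mul_of_one_le_left (ha β).le hM) (Nat.cast_nonneg L)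
        simpa using this
      exact h1.trans hL
    obtain ⟨hax, hall⟩ := hbox L β hβ hL'
    refine ⟨fun n hn h8 => ?_, fun x y i j i' j' hxy hij hij' => ?_⟩
    · have e : (n : ℝ) * (M * a β) / M = (n : ℝ) * a β := by field_simp
      simp only [e]
      exact hax n hn h8
    · have e : torusDist L x y * (M * a β) / M = torusDist L x y * a β := by field_simp
      simp only [e]
      exact hall x y i j i' j' hxy hij hij'

/-- **Rescaling up is free for the skewness package** as well (`Γ₃'(s) := Γ₃(s/M)`, same `β₁, ℓ₁, c₃`). -/
theorem skewnessPackage_const_mul (r : LatticeRep G) {a : ℝ → ℝ} (ha : ∀ β, 0 < a β) (h : SkewnessPackage r a) {M : ℝ}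
    (hM : 1 ≤ M) : SkewnessPackage r (fun β => M * a β) := by
  obtain ⟨Γ₃, β₁, ℓ₁, c₃, hℓ₁, hc₃, hΓ₃, hb⟩ := h
  have hM0 : 0 < M := lt_of_lt_of_le one_pos hM
  refine ⟨fun s => Γ₃ (s / M), β₁, ℓ₁, c₃, hℓ₁, hc₃, fun s hs hsℓ => hΓ₃ (s / M) (div_pos hs hM0) ?_, ?_⟩
  · rw [div_le_iff₀ hM0]
    nlinarith
  · intro L _ β hβ hL n hn h8
    have hL' : (L : ℝ) * a β ≤ ℓ₁ := by
      have h1 : (L : ℝ) * a β ≤ (L : ℝ) * (M * a β) := by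
        have := mul_le_mul_of_nonneg_left (le_mul_of_one_le_left (ha β).le hM) (Nat.cast_nonneg L)
        simpa using this
      exact h1.trans hL
    have e : (n : ℝ) * (M * a β) / M = (n : ℝ) * a β := by field_simp
    simp only [e]
    exact hb L β hβ hL' n hn h8

/-- **The rebundling realised**: if `a` answers the crux at `(G, r)`, so does `M·a` for every `M ≥ 1` (deeper-femto windows). -/
theorem answer_const_mul (r : LatticeRep G) {a : ℝ → ℝ} (h : Continuous a ∧ TwoPointPackage r a ∧ SkewnessPackage r a)
    {M : ℝ} (hM : 1 ≤ M) :
    Continuous (fun β => M * a β) ∧ TwoPointPackage r (fun β => M * a β) ∧ SkewnessPackage r (fun β => M * a β) := by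
  obtain ⟨hc, hP, hS⟩ := h
  obtain ⟨Γ, β₀, ℓ₀, c, C, -, -, ha, -, -⟩ := id hP
  exact ⟨continuous_const.mul hc, twoPointPackage_const_mul r hP hM, skewnessPackage_const_mul r ha hS hM⟩

/-- **…and constants are ALL the freedom there is**: any two CONTINUOUS maps carrying two-point packages for the same `(G, r)` are
equivalent up to a constant, eventually (the landed ruler rigidity of line `one-ruler`, read in the `TwoPointPackage` vocabulary).
So the map named by the conclusion is `≍` the hypothesis' map: the prover may deepen the windows (`answer_const_mul`), never move
them to another scale — which is why kill criterion II (`not_cruxC_of_zeros_in_shrinking_boxes`) is exact. -/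
theorem continuous_package_maps_comparable (r : LatticeRep G) {a₁ a₂ : ℝ → ℝ} (h₁ : TwoPointPackage r a₁)
    (h₂ : TwoPointPackage r a₂) (hc₁ : Continuous a₁) (hc₂ : Continuous a₂) :
    ∃ K β₃ : ℝ, 0 < K ∧ ∀ β : ℝ, β₃ ≤ β → a₂ β ≤ K * a₁ β ∧ a₁ β ≤ K * a₂ β := by
  obtain ⟨Γ₁, β₀, ℓ₀, c, C, h₁'⟩ := h₁
  obtain ⟨Γ₂, β₀', ℓ₀', c', C', h₂'⟩ := h₂
  exact rulerRigidity_continuous G r a₁ a₂ Γ₁ Γ₂ β₀ ℓ₀ c C β₀' ℓ₀' c' C' h₁' h₂' hc₁ hc₂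

end Freedom

/-! ## §4 Kill-criterion corollaries on a fixed torus (analyticity) -/

section FixedTorus

variable {G : Type} [Group G] [TopologicalSpace G] [IsTopologicalGroup G] [CompactSpace G]
  [MeasurableSpace G] [BorelSpace G]

/-- **Dichotomy on each fixed torus** (landed `kappa3_zero_set_dichotomy`, real-analyticity in `β`): either `κ₃(L, ·, n) ≡ 0`
on `ℝ`, or its zeros are isolated.  Hence "frequently zero as `β → ∞`" (kill criterion I) means: identically zero, or isolated
zeros ACCUMULATING at `+∞` — a genuine infinite sign pattern, not an accident of finitely many crossings. -/
theorem frequently_zero_cases (r : LatticeRep G) (L : ℕ) [NeZero L] (n : ℕ)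
    (hfreq : ∃ᶠ β in atTop, kappa3 r L β n = 0) :
    (∀ β : ℝ, kappa3 r L β n = 0) ∨
      ((∀ β₀ : ℝ, ∀ᶠ β in 𝓝[≠] β₀, kappa3 r L β n ≠ 0) ∧
        ∀ b : ℝ, ∃ β : ℝ, b ≤ β ∧ kappa3 r L β n = 0) := by
  rcases kappa3_zero_set_dichotomy r L n with h | h
  · exact Or.inl h
  · refine Or.inr ⟨h, fun b => ?_⟩
    obtain ⟨β, hβ, hb⟩ := (hfreq.and_eventually (eventually_ge_atTop b)).exists
    exact ⟨β, hb, hβ⟩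

/-- **Kill criterion I, identically-zero form**: a continuous package witness for `(G, r)` plus ONE torus `L ≥ 8n` on which the
cumulant vanishes IDENTICALLY in `β` refutes the crux.  (For SU(2) fundamental at `n = 1` the strong-coupling expansion gives
`κ₃(P,P,P) = +β⁹/256 + O(β¹⁰) ≢ 0`, sibling Disproof finding 3 — so this door is shut wherever a leading coefficient is known.) -/
theorem not_cruxC_of_identically_zero_torus
    (h : ∃ (G : Type) (_ : Group G) (_ : TopologicalSpace G) (_ : IsTopologicalGroup G)
      (_ : CompactSpace G) (_ : IsCompactSimpleLieGroup G),
      letI : MeasurableSpace G := borel G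
      haveI : BorelSpace G := ⟨rfl⟩
      ∃ (r : LatticeRep G) (a₀ : ℝ → ℝ), Continuous a₀ ∧ TwoPointPackage r a₀ ∧
        ∃ (L : ℕ) (_ : NeZero L) (n : ℕ), 1 ≤ n ∧ 8 * n ≤ L ∧ ∀ β : ℝ, kappa3 r L β n = 0) :
    ¬ FemtoCurvatureSkewnessC := by
  obtain ⟨G, _, _, _, _, hG, r, a₀, ha₀, h₀, L, _, n, hn, h8, hz⟩ := h
  exact not_cruxC_of_frequently_zero
    ⟨G, _, _, _, _, hG, r, a₀, ha₀, h₀, L, ‹_›, n, hn, h8, Frequently.of_forall hz⟩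

end FixedTorus

/-! ## §5 Near-misses and targets (cycle 1)

* TARGETS: none served (`payload.targets = []`; line `ratio-transport` picked at 19:11Z after this seat started — audit in the
  module docblock, finding 6; no stub is cheaply refutable; S is provable now, M closes abstractly, A is finding 2 with value,
  E is the engine).
* NEAR-MISS A (blocked = the shield): `∃ a, Continuous a ∧ TwoPointPackage r a` for SU(2) fundamental — this IS crux 16204.
* NEAR-MISS B (the only live kill pattern, believed FALSE): zeros of `κ₃` in physically shrinking boxes along `β → ∞` — would
  contradict tree-level positivity protected by asymptotic freedom; no `(G, r)` candidate, no printed hint.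
* NOT a near-miss any more (closed by the repair): confinement-scale zeros of `κ₃` for `(G, r)` with strong-coupling sign `−`
  (SU(3) fundamental, adjoint reps): inadmissible for every continuous package map (finding 4).
* Numerical record (inherited, crux 9365): SU(2) `L = 6, 8`, `n = 1`: `κ₃ > 0` (7–34σ) for `β_tree ∈ [0.9, 3.0]`, ratio
  `κ₃/Cov^{3/2} ≈ 0.40–0.51`, `κ₃/κ₃^perm = 0.86–0.93 ± 0.06` for `β_tree ≥ 1.5` (MCSignScan-c1, j008044/j008055/j014620).  No new
  compute this cycle: the discriminating RG-chain measurement (`n = 2, 3` on `16⁴, 24⁴`) needs multilevel variance reduction for a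
  `2⁻¹²`-suppressed signal and could only CONFIRM the expected `+` sign in the UV; it cannot produce a kill.
-/

end Summit.QuantumFields.YangMills.Cruxes.FemtoCurvatureSkewnessC.Disproof

end
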